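import Summits.AtomisticToContinuum.Crystallization.Theses.FluxTubeKepler
import Summits.AtomisticToContinuum.Crystallization.Theorems.SquareWellLayerCakeGapTwelveToBarlowUniformSpacingSelectionHull

/-!
# `FluxTubeKepler.FloorGivesLayered` (stmt-AtomisticToContinuum-15223) — audit-clean THEOREMS-SHAPED PORT
of the standing `Cruxes/FloorGivesLayered/Disproof.lean` candidate proof (crux-ideate idea
`land-dilation-diagonal`, planner-cruxidea-stmt-AtomisticToContinuum-15223-1-0, 2026-08-17).

Differences from `Disproof.lean` (refuter-rattack-stmt-AtomisticToContinuum-15223-0), whose mathematics is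
kept verbatim: (i) namespace as a prover's `Theorems/FluxTubeKeplerFloorGivesLayered.lean`; imports are the
route file and one Theorems file only (the `Cruxes/` workfile module is NOT importable on the farm:
`remote:stale:unbuilt`); (ii) NO Prop-valued helper definitions (`Floor`, `Budget`, `Good`, `GoodAt`, `Concl`
of the Disproof are flagged `tree.vendored-fact` by the file audit under `Summit.*`): the good-site
predicates become the `Set (Fin N)`-valued `goodAt` / `good` with `Iff.rfl` membership lemmas, FLOOR and
BUDGET are spelled out literally in `eventuallyGoodSite`; (iii) the four orphan lemmas (`crux_iff`,
`crux_iff_budget_only`, `crux_iff_minimiser`, `floor_of_budget`) are dropped (`tree.orphan`).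
Mechanism: ENERGY ⇒ GOOD SITES (`e(P₀) = e*` by `crysEnergyLimit` + `eStar_le` + `card_mul_eStar_le`, so the
budget leaves a good site eventually) and ONE SPACING FOR ALL SCALES (diagonal over scales `(k+2, 1/(k+1))`,
Bolzano–Weierstrass on `[47/50, 1]`, DILATION COVARIANCE of the relaxed layered family: rescale the whole
datum `(a, z) ↦ (ρa, ρz)`).
-/

noncomputable section

namespace Summit.AtomisticToContinuum.Crystallization.Theorems.FluxTubeKeplerFloorGivesLayered

open Literature.MathematicalPhysics.StatisticalMechanics Filter Topology
open Summit.AtomisticToContinuum.Crystallization.Theses.FluxTubeKepler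
open Summit.AtomisticToContinuum.Crystallization.Theorems.ChargedEnergyGapNegative
open Summit.AtomisticToContinuum.Crystallization.Theorems.SquareWellLayerCakeGapTwelveToBarlow
  (sel_inplane_eq)

/-- `ℝ³`. -/
abbrev E3 := EuclideanSpace ℝ (Fin 3)

/-- The relaxed layered set of data `(A, a, s, z)` (verbatim the set of the crux). -/
def layeredSet (A : EuclideanSpace ℝ (Fin 3) →ₗᵢ[ℝ] EuclideanSpace ℝ (Fin 3)) (a : ℝ) (s : ℤ → ℤ)
    (z : ℤ → ℝ) : Set (EuclideanSpace ℝ (Fin 3)) :=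
  {p | ∃ m k l : ℤ, p = A (((k : ℝ) • Literature.MathematicalPhysics.StatisticalMechanics.triangularVec₁ a) + ((l : ℝ) • Literature.MathematicalPhysics.StatisticalMechanics.triangularVec₂ a) + ((Literature.MathematicalPhysics.StatisticalMechanics.haggLabel s m : ℝ) • Literature.MathematicalPhysics.StatisticalMechanics.barlowOffset a) + (z m • Literature.MathematicalPhysics.StatisticalMechanics.layerNormal 1))}

/-- The set of sites `i` of `x` that are layered-good at spacing EXACTLY `a`, scale `(R, η)` (data, not a
Prop definition). -/
def goodAt (a R η : ℝ) {N : ℕ} (x : Fin N → E3) : Set (Fin N) :=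
  {i | ∃ (A : EuclideanSpace ℝ (Fin 3) →ₗᵢ[ℝ] EuclideanSpace ℝ (Fin 3)) (s : ℤ → ℤ) (z : ℤ → ℝ), Literature.MathematicalPhysics.StatisticalMechanics.IsHaggSeq s ∧ (∀ m : ℤ, 39 / 50 * a ≤ z (m + 1) - z m ∧ z (m + 1) - z m ≤ 17 / 20 * a) ∧ let S : Set (EuclideanSpace ℝ (Fin 3)) := layeredSet A a s z; (∀ p ∈ S, ‖p‖ ≤ R → ∃ j : Fin N, dist (x j - x i) p ≤ η) ∧ (∀ j : Fin N, ‖x j - x i‖ ≤ R → ∃ p ∈ S, dist (x j - x i) p ≤ η)}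

/-- The set of `(R, η)`-layered-good sites of `x` (spacing free in `[47/50, 1]`; its complement is the set
counted by the crux's `Nat.card`). -/
def good (R η : ℝ) {N : ℕ} (x : Fin N → E3) : Set (Fin N) :=
  {i | ∃ a : ℝ, 47 / 50 ≤ a ∧ a ≤ 1 ∧ i ∈ goodAt a R η x}

theorem mem_goodAt {a R η : ℝ} {N : ℕ} {x : Fin N → E3} {i : Fin N} :
    i ∈ goodAt a R η x ↔ ∃ (A : EuclideanSpace ℝ (Fin 3) →ₗᵢ[ℝ] EuclideanSpace ℝ (Fin 3)) (s : ℤ → ℤ) (z : ℤ → ℝ), Literature.MathematicalPhysics.StatisticalMechanics.IsHaggSeq s ∧ (∀ m : ℤ, 39 / 50 * a ≤ z (m + 1) - z m ∧ z (m + 1) - z m ≤ 17 / 20 * a) ∧ let S : Set (EuclideanSpace ℝ (Fin 3)) := layeredSet A a s z; (∀ p ∈ S, ‖p‖ ≤ R → ∃ j : Fin N, dist (x j - x i) p ≤ η) ∧ (∀ j : Fin N, ‖x j - x i‖ ≤ R → ∃ p ∈ S, dist (x j - x i) p ≤ η) :=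
  Iff.rfl

theorem mem_good {R η : ℝ} {N : ℕ} {x : Fin N → E3} {i : Fin N} :
    i ∈ good R η x ↔ ∃ a : ℝ, 47 / 50 ≤ a ∧ a ≤ 1 ∧ i ∈ goodAt a R η x :=
  Iff.rfl

/-! ## 1. ENERGY ⇒ GOOD SITES -/

/-- FLOOR(P₀) holds iff `P₀` ATTAINS the periodic infimum `e*`.  So the crux's hypotheses are about
a periodic minimiser; for every other `P₀` they are vacuous. -/
theorem floor_iff_eq_eStar (P₀ : PeriodicConfiguration 3) :
    (∀ (N : ℕ) (x : Fin N → EuclideanSpace ℝ (Fin 3)), Literature.MathematicalPhysics.StatisticalMechanics.IsGroundState Literature.MathematicalPhysics.StatisticalMechanics.lennardJones x → (N : ℝ) * P₀.energyPerParticle Literature.MathematicalPhysics.StatisticalMechanics.lennardJones ≤ Literature.MathematicalPhysics.StatisticalMechanics.interactionEnergy Literature.MathematicalPhysics.StatisticalMechanics.lennardJones x) ↔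
      P₀.energyPerParticle lennardJones = eStar := by
  constructor
  · intro hE
    have hlim := crysEnergyLimit
    have hle : P₀.energyPerParticle lennardJones ≤ eStar := by
      refine ge_of_tendsto hlim (Filter.eventually_atTop.2 ⟨1, fun N hN => ?_⟩)
      obtain ⟨x, hx⟩ := LennardJonesGroundStatesExist_holds N
      have h1 := hE N x hx
      have hNr : (0 : ℝ) < N := by exact_mod_cast hN
      rw [le_div_iff₀ hNr, mul_comm]
      rw [hx.2] at h1
      exact h1
    exact le_antisymm hle (eStar_le P₀)
  · intro heq N x hx
    rw [heq]
    exact card_mul_eStar_le hx.1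

/-- Under FLOOR and BUDGET, at every scale `R, η > 0`, eventually in `N`, every Lennard-Jones ground
state of `N` particles has an `(R, η)`-layered-good site: `e(P₀) = e*`, `E(N)/N → e*`, so eventually
`E(N) < N (e* + c)` and BUDGET gives `c·#bad < c·N`. -/
theorem eventuallyGoodSite (P₀ : PeriodicConfiguration 3) 
    (hE : ∀ (N : ℕ) (x : Fin N → EuclideanSpace ℝ (Fin 3)), Literature.MathematicalPhysics.StatisticalMechanics.IsGroundState Literature.MathematicalPhysics.StatisticalMechanics.lennardJones x → (N : ℝ) * P₀.energyPerParticle Literature.MathematicalPhysics.StatisticalMechanics.lennardJones ≤ Literature.MathematicalPhysics.StatisticalMechanics.interactionEnergy Literature.MathematicalPhysics.StatisticalMechanics.lennardJones x)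
    (hD : ∀ R η : ℝ, 0 < R → 0 < η → ∃ c : ℝ, 0 < c ∧ ∀ (N : ℕ) (x : Fin N → EuclideanSpace ℝ (Fin 3)), Literature.MathematicalPhysics.StatisticalMechanics.IsGroundState Literature.MathematicalPhysics.StatisticalMechanics.lennardJones x → c * (Nat.card {i : Fin N // i ∉ good R η x} : ℝ) ≤ Literature.MathematicalPhysics.StatisticalMechanics.interactionEnergy Literature.MathematicalPhysics.StatisticalMechanics.lennardJones x - (N : ℝ) * P₀.energyPerParticle Literature.MathematicalPhysics.StatisticalMechanics.lennardJones)
    (R η : ℝ) (hR : 0 < R) (hη : 0 < η) :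
    ∀ᶠ N in atTop, ∀ x : Fin N → E3, IsGroundState lennardJones x →
      ∃ i : Fin N, i ∈ good R η x := by
  have heq := (floor_iff_eq_eStar P₀).1 hE
  obtain ⟨c, hc, hcN⟩ := hD R η hR hη
  have hlim := crysEnergyLimit
  have hlt : (⨅ Q : PeriodicConfiguration 3, Q.energyPerParticle lennardJones) < eStar + c := by
    change eStar < eStar + c
    linarith
  have hev : ∀ᶠ N : ℕ in atTop, groundStateEnergy lennardJones 3 N / N < eStar + c :=
    hlim.eventually (gt_mem_nhds hlt)
  filter_upwards [hev, Filter.eventually_gt_atTop 0] with N hN hNpos x hx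
  have h1 := hcN N x hx
  rw [heq, hx.2] at h1
  have hNr : (0 : ℝ) < N := by exact_mod_cast hNpos
  have h2 : groundStateEnergy lennardJones 3 N < (eStar + c) * N := by
    rwa [div_lt_iff₀ hNr] at hN
  have h3 : c * (Nat.card {i : Fin N // i ∉ good R η x} : ℝ) < c * N := by nlinarith
  have h4 : (Nat.card {i : Fin N // i ∉ good R η x} : ℝ) < N := lt_of_mul_lt_mul_left h3 hc.le
  have h5 : Nat.card {i : Fin N // i ∉ good R η x} < N := by exact_mod_cast h4
  by_contra hno
  have hno' : ∀ i : Fin N, i ∉ good R η x := fun i hi => hno ⟨i, hi⟩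
  have hcard : Nat.card {i : Fin N // i ∉ good R η x} = N := by
    rw [Nat.card_congr (Equiv.subtypeUnivEquiv hno')]
    simp
  omega

/-! ## 2. ONE SPACING FOR ALL SCALES (dilation covariance + diagonal extraction) -/

/-- DILATION COVARIANCE of the layered family: the layered point of spacing `ρ b` and heights `ρ z`
is the `ρ`-dilate of the layered point of spacing `b` and heights `z` (same chart, same word). -/
theorem layered_pt_scale (A : EuclideanSpace ℝ (Fin 3) →ₗᵢ[ℝ] EuclideanSpace ℝ (Fin 3)) (ρ b : ℝ)
    (s : ℤ → ℤ) (z : ℤ → ℝ) (m k l : ℤ) :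
    A (((k : ℝ) • triangularVec₁ (ρ * b)) + ((l : ℝ) • triangularVec₂ (ρ * b)) +
        ((haggLabel s m : ℝ) • barlowOffset (ρ * b)) + ((ρ * z m) • layerNormal 1)) =
      ρ • A (((k : ℝ) • triangularVec₁ b) + ((l : ℝ) • triangularVec₂ b) +
        ((haggLabel s m : ℝ) • barlowOffset b) + (z m • layerNormal 1)) := by
  rw [← LinearIsometry.map_smul]
  congr 1
  rw [sel_inplane_eq (ρ * b) k l, sel_inplane_eq b k l]
  module

/-- **Stub 2.** For every sequence of finite configurations: good sites frequently in `N` at every scale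
`(R, η)`, with scale- and `N`-dependent spacings in `[47/50, 1]`, give ONE spacing `a ∈ [47/50, 1]`
with good sites at spacing exactly `a`, frequently in `N`, at every scale `(R, ε)`. -/
theorem spacingSelection (x : (N : ℕ) → (Fin N → E3))
    (h : ∀ R η : ℝ, 0 < R → 0 < η → ∃ᶠ N in atTop, ∃ i : Fin N, i ∈ good R η (x N)) :
    ∃ a : ℝ, 47 / 50 ≤ a ∧ a ≤ 1 ∧ ∀ R ε : ℝ, 0 < R → 0 < ε →
      ∃ᶠ N in atTop, ∃ i : Fin N, i ∈ goodAt a R ε (x N) := by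
  -- Step 1: a diagonal family of good sites at the scales `(k + 2, 1/(k + 1))`, indices `N_k ≥ k`
  have hk : ∀ k : ℕ, ∃ N : ℕ, k ≤ N ∧ ∃ i : Fin N, ∃ a : ℝ, 47 / 50 ≤ a ∧ a ≤ 1 ∧
      i ∈ goodAt a ((k : ℝ) + 2) (1 / ((k : ℝ) + 1)) (x N) := by
    intro k
    obtain ⟨N, hN, i, hgi⟩ := Filter.frequently_atTop.1
      (h ((k : ℝ) + 2) (1 / ((k : ℝ) + 1)) (by positivity) (by positivity)) k
    obtain ⟨a, ha1, ha2, hg⟩ := mem_good.1 hgi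
    exact ⟨N, hN, i, a, ha1, ha2, hg⟩
  choose Nk hNk ik ak hak1 hak2 hgood using hk
  -- Step 2: Bolzano–Weierstrass on `[47/50, 1]`
  obtain ⟨aS, haS, φ, hφ, hlim⟩ :=
    (isCompact_Icc : IsCompact (Set.Icc (47 / 50 : ℝ) 1)).tendsto_subseq (fun k => ⟨hak1 k, hak2 k⟩)
  refine ⟨aS, haS.1, haS.2, fun R ε hR hε => ?_⟩
  have haS0 : 0 < aS := by linarith [haS.1]
  -- Step 3: for a target `(R, ε)` and a threshold `M`, a late enough index of the subsequence works
  rw [Filter.frequently_atTop]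
  intro M
  obtain ⟨η', hη'0, hη'ε, hη'1⟩ : ∃ η' : ℝ, 0 < η' ∧ η' ≤ ε ∧ η' ≤ 1 :=
    ⟨min ε 1, lt_min hε one_pos, min_le_left _ _, min_le_right _ _⟩
  have hR1 : 0 < R + 1 := by linarith
  obtain ⟨θ, hθ0, hθR⟩ : ∃ θ : ℝ, 0 < θ ∧ θ * (R + 1) = η' / 2 :=
    ⟨η' / 2 / (R + 1), by positivity, by field_simp⟩
  obtain ⟨K₁, hK₁⟩ := Metric.tendsto_atTop.1 hlim (47 / 50 * θ) (by positivity)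
  obtain ⟨K₂, hK₂⟩ := exists_nat_ge R
  obtain ⟨K₃, hK₃⟩ := exists_nat_ge (2 / η')
  obtain ⟨k, hkM, hkK₁, hkK₂, hkK₃⟩ : ∃ k : ℕ, M ≤ k ∧ K₁ ≤ k ∧ K₂ ≤ k ∧ K₃ ≤ k :=
    ⟨max (max M K₁) (max K₂ K₃),
      le_trans (le_max_left _ _) (le_max_left _ _), le_trans (le_max_right _ _) (le_max_left _ _),
      le_trans (le_max_left _ _) (le_max_right _ _), le_trans (le_max_right _ _) (le_max_right _ _)⟩
  have hφk : k ≤ φ k := hφ.id_le k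
  -- the data at index `φ k`
  have hg := hgood (φ k)
  have hb1 := hak1 (φ k)
  have hb2 := hak2 (φ k)
  have hab : dist (ak (φ k)) aS < 47 / 50 * θ := hK₁ k hkK₁
  generalize hbdef : ak (φ k) = b at hg hb1 hb2 hab
  have hb0 : 0 < b := by linarith
  have habs : |b - aS| < 47 / 50 * θ := by rwa [Real.dist_eq] at hab
  -- the dilation factor
  obtain ⟨ρ, hρ0, hρb⟩ : ∃ ρ : ℝ, 0 < ρ ∧ ρ * b = aS :=
    ⟨aS / b, div_pos haS0 hb0, div_mul_cancel₀ aS hb0.ne'⟩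
  have h1ρ : |1 - ρ| ≤ θ := by
    have e1 : 1 - ρ = (b - aS) / b := by rw [← hρb]; field_simp
    rw [e1, abs_div, abs_of_pos hb0, div_le_iff₀ hb0]
    nlinarith [abs_nonneg (b - aS)]
  have h1ρ' : |ρ⁻¹ - 1| ≤ θ := by
    have e1 : ρ⁻¹ - 1 = (b - aS) / aS := by rw [← hρb]; field_simp
    rw [e1, abs_div, abs_of_pos haS0, div_le_iff₀ haS0]
    nlinarith [abs_nonneg (b - aS), haS.1]
  -- the scales at index `φ k`
  have hRk : R + 1 ≤ (φ k : ℝ) + 2 := by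
    have e1 : (k : ℝ) ≤ φ k := by exact_mod_cast hφk
    have e2 : (K₂ : ℝ) ≤ k := by exact_mod_cast hkK₂
    linarith
  have hηk : 1 / ((φ k : ℝ) + 1) ≤ η' / 2 := by
    have e1 : (k : ℝ) ≤ φ k := by exact_mod_cast hφk
    have e2 : (K₃ : ℝ) ≤ k := by exact_mod_cast hkK₃
    have e3 : 2 / η' ≤ (φ k : ℝ) + 1 := by linarith
    rw [div_le_iff₀ hη'0] at e3
    rw [div_le_iff₀ (by positivity)]
    linarith
  -- unpack the good site and rescale its data
  obtain ⟨A, s, z, hs, hbox, hM1, hM2⟩ := mem_goodAt.1 hg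
  refine ⟨Nk (φ k), le_trans hkM (le_trans hφk (hNk (φ k))), ik (φ k),
    mem_goodAt.2 ⟨A, s, fun m => ρ * z m, hs, fun m => ?_, ?_⟩⟩
  · -- the spacing box scales with `ρ`
    obtain ⟨hl, hu⟩ := hbox m
    have hl' := mul_le_mul_of_nonneg_left hl hρ0.le
    have hu' := mul_le_mul_of_nonneg_left hu hρ0.le
    constructor
    · calc 39 / 50 * aS = ρ * (39 / 50 * b) := by rw [← hρb]; ring
        _ ≤ ρ * (z (m + 1) - z m) := hl'
        _ = ρ * z (m + 1) - ρ * z m := by ring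
    · calc ρ * z (m + 1) - ρ * z m = ρ * (z (m + 1) - z m) := by ring
        _ ≤ ρ * (17 / 20 * b) := hu'
        _ = 17 / 20 * aS := by rw [← hρb]; ring
  · -- the two-way match at `(R, ε)` for the dilated set
    have hscale : ∀ m k' l : ℤ, A (((k' : ℝ) • triangularVec₁ aS) + ((l : ℝ) • triangularVec₂ aS) +
        ((haggLabel s m : ℝ) • barlowOffset aS) + ((ρ * z m) • layerNormal 1)) =
        ρ • A (((k' : ℝ) • triangularVec₁ b) + ((l : ℝ) • triangularVec₂ b) +
        ((haggLabel s m : ℝ) • barlowOffset b) + (z m • layerNormal 1)) := by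
      intro m k' l
      rw [← hρb]
      exact layered_pt_scale A ρ b s z m k' l
    set q : Fin (Nk (φ k)) → E3 := fun j => x (Nk (φ k)) j - x (Nk (φ k)) (ik (φ k)) with hq
    dsimp only
    constructor
    · -- every point of the dilated set in `‖·‖ ≤ R` has a particle within `ε`
      rintro p' ⟨m, k', l, rfl⟩ hp'R
      set p : E3 := A (((k' : ℝ) • triangularVec₁ b) + ((l : ℝ) • triangularVec₂ b) +
        ((haggLabel s m : ℝ) • barlowOffset b) + (z m • layerNormal 1)) with hpdef
      rw [hscale m k' l] at hp'R ⊢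
      have hpS : p ∈ layeredSet A b s z := ⟨m, k', l, rfl⟩
      have hdiff : dist p (ρ • p) ≤ η' / 2 := by
        have e1 : p - ρ • p = (ρ⁻¹ - 1) • (ρ • p) := by
          rw [sub_smul, smul_smul, inv_mul_cancel₀ hρ0.ne', one_smul, one_smul]
        rw [dist_eq_norm, e1, norm_smul, Real.norm_eq_abs, ← hθR]
        exact mul_le_mul h1ρ' (by linarith) (norm_nonneg _) hθ0.le
      have hpR : ‖p‖ ≤ (φ k : ℝ) + 2 := by
        have e1 := norm_le_norm_add_norm_sub' p (ρ • p)
        rw [← dist_eq_norm] at e1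
        linarith
      obtain ⟨j, hj⟩ := hM1 p hpS hpR
      refine ⟨j, ?_⟩
      calc dist (q j) (ρ • p) ≤ dist (q j) p + dist p (ρ • p) := dist_triangle _ _ _
        _ ≤ 1 / ((φ k : ℝ) + 1) + η' / 2 := add_le_add hj hdiff
        _ ≤ ε := by linarith
    · -- every particle in `‖·‖ ≤ R` has a point of the dilated set within `ε`
      intro j hj
      obtain ⟨p, ⟨m, k', l, rfl⟩, hd⟩ := hM2 j (hj.trans (by linarith))
      refine ⟨ρ • A (((k' : ℝ) • triangularVec₁ b) + ((l : ℝ) • triangularVec₂ b) +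
        ((haggLabel s m : ℝ) • barlowOffset b) + (z m • layerNormal 1)), ⟨m, k', l, ?_⟩, ?_⟩
      · exact (hscale m k' l).symm
      · set p : E3 := A (((k' : ℝ) • triangularVec₁ b) + ((l : ℝ) • triangularVec₂ b) +
          ((haggLabel s m : ℝ) • barlowOffset b) + (z m • layerNormal 1)) with hpdef
        have hpR : ‖p‖ ≤ R + 1 := by
          have e1 : dist p 0 ≤ dist (q j) p + dist (q j) 0 := by
            have e0 := dist_triangle p (q j) 0
            rwa [dist_comm p (q j)] at e0
          rw [dist_zero_right, dist_zero_right] at e1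
          have e3 : ‖q j‖ ≤ R := hj
          linarith
        have hdiff : dist p (ρ • p) ≤ η' / 2 := by
          have e1 : p - ρ • p = (1 - ρ) • p := by rw [sub_smul, one_smul]
          rw [dist_eq_norm, e1, norm_smul, Real.norm_eq_abs, ← hθR]
          exact mul_le_mul h1ρ hpR (norm_nonneg _) hθ0.le
        calc dist (q j) (ρ • p) ≤ dist (q j) p + dist p (ρ • p) := dist_triangle _ _ _
          _ ≤ 1 / ((φ k : ℝ) + 1) + η' / 2 := add_le_add hd hdiff
          _ ≤ ε := by linarith

/-! ## 3. The crux -/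

/-- **`FloorGivesLayered` holds** (composition of `eventuallyGoodSite` and `spacingSelection`; read the
fixed-spacing good site at radius `max R 1` and translate by `t := −x N i`). -/
theorem floorGivesLayered : FloorGivesLayered := by
  intro P₀ hE hD x hx
  have hgood : ∀ R η : ℝ, 0 < R → 0 < η → ∃ᶠ N in atTop, ∃ i : Fin N, i ∈ good R η (x N) :=
    fun R η hR hη =>
      ((eventuallyGoodSite P₀ hE hD R η hR hη).mono fun N hN => hN (x N) (hx N)).frequently
  obtain ⟨a, ha1, ha2, hwin⟩ := spacingSelection x hgood
  refine ⟨a, ha1, ha2, fun R ε hε => ?_⟩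
  have hR' : 0 < max R 1 := lt_max_of_lt_right one_pos
  refine (hwin (max R 1) ε hR' hε).mono fun N hN => ?_
  obtain ⟨i, hi⟩ := hN
  obtain ⟨A, s, z, hs, hbox, hM₁, hM₂⟩ := mem_goodAt.1 hi
  refine ⟨A, -x N i, s, z, hs, hbox, ?_⟩
  have hsub : ∀ j : Fin N, x N j + -x N i = x N j - x N i := fun j =>
    (sub_eq_add_neg (x N j) (x N i)).symm
  intro S
  refine ⟨fun p hp hpR => ?_, fun j hj => ?_⟩
  · obtain ⟨j, hj⟩ := hM₁ p hp (hpR.trans (le_max_left R 1))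
    exact ⟨j, by rw [hsub j]; exact hj⟩
  · rw [hsub j] at hj ⊢
    exact hM₂ j (hj.trans (le_max_left R 1))

/-- The crux by its fully qualified route name. -/
theorem FloorGivesLayered_of_port :
    Summit.AtomisticToContinuum.Crystallization.Theses.FluxTubeKepler.FloorGivesLayered :=
  floorGivesLayered

end Summit.AtomisticToContinuum.Crystallization.Theorems.FluxTubeKeplerFloorGivesLayered

end
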